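import Summits.CriticalPhenomena.PercolationContinuityZ3.Theorems.PercNearOneGluingNoHeavyQuantMagnetizationGrowth
import Summits.CriticalPhenomena.PercolationContinuityZ3.Theorems.PercNearOneGluingNoHeavyQuantChiFDivergence
import HarnessLib

/-!
# The finite-cluster susceptibility is not integrable at `p_c⁺`: `∫_{p_c}^{p} χ^f(r) dr = ∞` in every dimension `d ≥ 2`
# ("`γ' ≥ 1`" for every upper power-law envelope) — quant lane, METHOD = differential inequalities near `p_c`, seat p4 gen 6

builds on p205010 (kernel theorem, internal audit signed; external expert review pending).
Status sentence for p205010: "θ(p_c) = 0 on ℤ^d, all d ≥ 2 — kernel-verified (Lean 4/Mathlib, standard axioms); internal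
adversarial audit SIGNED 2026-08-20 04:29Z; external expert review pending."

Seat `prim-quant-p4`, `--supports stmt-CriticalPhenomena-4575`; pure proofs, no definitions.  `χ^f(p) = meanClusterSize (zdGraph d) 0 p`
(`= E_p[|C(0)|; |C(0)| < ∞] ∈ [0,∞]`), real parameters through `GhostField.prm r = projIcc 0 1 r`.

* `ChiF.measurable_chiGamma`, `ChiF.ofReal_integral_chiGamma_le_lintegral` — the green-free susceptibility `r ↦ χ(r,γ)` is a pointwise
  limit of polynomials (hence measurable, in `[0, 1/γ]`) and `∫_q^p χ(·,γ) ≤ ∫_q^p χ^f` (right side a lower Lebesgue integral — no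
  measurability or finiteness of `χ^f` is used).
* **`ChiF.lintegral_meanClusterSize_eq_top`** — for every `d ≥ 2` and `p ∈ (p_c, 1)`: `∫⁻_{(p_c, p)} χ^f = ∞`.  Proof: were it finite, it
  would be `< (1-p)/(4d)` on `(p_c, p')` for some `p' > p_c` (continuity from above of the finite measure `χ^f · Lebesgue`); then
  `…QuantMagnetizationGrowth` gives `M(q,γ) ≥ M(p',γ)/2 ≥ θ(p')/2` for all `q ∈ (p_c,p')`, `γ ∈ (0,1)`; `γ ↓ 0` gives `θ(q) ≥ θ(p')/2 > 0`
  and `q ↓ p_c` (right-continuity of `θ`, Grimmett Lemma (8.9), tree `theta_continuousWithinAt_Ici`) gives `θ(p_c) > 0`, contradicting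
  `θ(p_c) = 0` (p205010, `CSH.percolationContinuity_allDimensions`).
* **`ChiF.not_chiF_le_rpow_of_lt_one`** — hence NO bound `χ^f(p) ≤ A (p - p_c)^{-g}` with `g < 1` holds on any right neighbourhood of
  `p_c`: "`γ' ≥ 1`" in upper-envelope form, with no assumption on the existence of exponents.

HONEST STATUS.  For `3 ≤ d ≤ 10` this is stronger information than the pointwise rate of `…QuantChiFDivergence` (which is only
`χ^f ≥ c/ω(p-p_c)` with the lane's iterated-logarithm modulus): it excludes every integrable power envelope.  Printed neighbours:
C. M. Newman, J. Stat. Phys. 47 (1987) 695–699 proves `γ' ≥ 2(1-1/δ)` (`≥ 1`) ASSUMING the exponents `γ'` and `δ` exist (Grimmett 1999,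
§10.4 notes); Kesten (1982, Thm. 8.1 (8.6)) has two-sided power bounds in `d = 2`; Heydenreich–van der Hofstad (2017, Open Problem 11.1)
ask for existence and value of `γ'` in high dimensions.  We found no printed unconditional statement of the present form; it is an
elementary consequence of Aizenman–Barsky 1987 and `θ(p_c) = 0`, and is claimed as nothing more.

## References
* G. Grimmett, *Percolation*, 2nd ed. (1999), §5.3 Lemma (5.51); §8.3 Lemma (8.9); §10.4 notes [GrimmettPercolation1999].
* M. Aizenman, D. J. Barsky, Comm. Math. Phys. 108 (1987) 489–526 [AizenmanBarsky1987].
* C. M. Newman, J. Stat. Phys. 47 (1987) 695–699 [Newman1987BetaDelta].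
* M. Heydenreich, R. van der Hofstad (2017), Open Problem 11.1 [HeydenreichVanDerHofstad2017].
-/

noncomputable section

namespace Summit.CriticalPhenomena.PercolationContinuityZ3.Theorems

open MeasureTheory Set Filter Topology Literature.Probability.Percolation Literature.Probability.LatticeModels
open scoped Classical ENNReal

namespace ChiF

/-! ### §11. Non-integrability of `χ^f` at `p_c⁺`: `∫_{p_c}^{p} χ^f(r) dr = ∞` in every dimension `d ≥ 2` -/

section NonIntegrable

variable {d : ℕ}

/-- Continuity in `r` of `(1-γ)∂θ^{Λ_n}/∂γ` at parameter `prm r`. -/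
theorem continuous_one_sub_mul_dGamma_prm (γ : unitInterval) (n : ℕ) :
    Continuous fun r : ℝ => (1 - (γ : ℝ)) *
      GhostField.dGamma (G := (zdGraph d).comap (Subtype.val : (↑(box d n) : Set (Site d)) → Site d)) (GhostField.prm r) γ
        ⟨0, by exact_mod_cast zero_mem_box d n⟩ :=
  continuous_const.mul (continuous_dGamma_prm γ n _)

/-- `(1-γ)∂θ^{Λ_n}/∂γ (prm r) → χ(prm r, γ) = Σ_S |S|(1-γ)^{|S|} P_{prm r}(C(0)=S)` as `n → ∞`, for every real `r`. -/
theorem tendsto_one_sub_mul_dGamma_prm (γ : unitInterval) (hγ0 : 0 < (γ : ℝ)) (hγ1 : (γ : ℝ) ≤ 1) (r : ℝ) :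
    Tendsto (fun n : ℕ => (1 - (γ : ℝ)) *
      GhostField.dGamma (G := (zdGraph d).comap (Subtype.val : (↑(box d n) : Set (Site d)) → Site d)) (GhostField.prm r) γ
        ⟨0, by exact_mod_cast zero_mem_box d n⟩) atTop
      (𝓝 (∑' S : Finset (Site d), ((S.card : ℝ) * (1 - (γ : ℝ)) ^ S.card) *
        (bondPercolation (zdGraph d) (GhostField.prm r)).real (clusterIs 0 S))) := by
  have h := tendsto_integral_box_clusterFn' (d := d) (GhostField.prm r) (abs_mul_pow_le hγ0 hγ1) (tendsto_mul_pow hγ0 hγ1)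
  rw [zero_mul, zero_add] at h
  refine h.congr fun n => ?_
  rw [one_sub_mul_dGamma_boxGraph_eq_integral]

/-- `0 ≤ (1-γ)∂θ^{Λ_n}/∂γ ≤ 1/γ`. -/
theorem one_sub_mul_dGamma_prm_mem_Icc (γ : unitInterval) (hγ0 : 0 < (γ : ℝ)) (hγ1 : (γ : ℝ) ≤ 1) (n : ℕ) (r : ℝ) :
    (1 - (γ : ℝ)) *
      GhostField.dGamma (G := (zdGraph d).comap (Subtype.val : (↑(box d n) : Set (Site d)) → Site d)) (GhostField.prm r) γ
        ⟨0, by exact_mod_cast zero_mem_box d n⟩ ∈ Set.Icc (0 : ℝ) (1 / γ) := by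
  rw [one_sub_mul_dGamma_boxGraph_eq_integral]
  refine ⟨integral_nonneg fun ω => mul_nonneg (Nat.cast_nonneg _) (pow_nonneg (by linarith) _), ?_⟩
  calc _ ≤ ∫ ω, (1 / (γ : ℝ)) ∂(bondPercolation (zdGraph d) (GhostField.prm r)) := by
        refine integral_mono_of_nonneg (Eventually.of_forall fun ω => ?_) (integrable_const _)
          (Eventually.of_forall fun ω => mul_pow_le_inv hγ0 hγ1 _)
        exact mul_nonneg (Nat.cast_nonneg _) (pow_nonneg (by linarith) _)
    _ = 1 / (γ : ℝ) := by simp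

/-- The green-free susceptibility along the real parameter, `r ↦ χ(prm r, γ)`, is measurable (a pointwise limit of polynomials)
and takes values in `[0, 1/γ]`. -/
theorem measurable_chiGamma (γ : unitInterval) (hγ0 : 0 < (γ : ℝ)) (hγ1 : (γ : ℝ) ≤ 1) :
    Measurable (fun r : ℝ => ∑' S : Finset (Site d), ((S.card : ℝ) * (1 - (γ : ℝ)) ^ S.card) *
        (bondPercolation (zdGraph d) (GhostField.prm r)).real (clusterIs 0 S)) ∧
      ∀ r : ℝ, (∑' S : Finset (Site d), ((S.card : ℝ) * (1 - (γ : ℝ)) ^ S.card) *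
        (bondPercolation (zdGraph d) (GhostField.prm r)).real (clusterIs 0 S)) ∈ Set.Icc (0 : ℝ) (1 / γ) := by
  refine ⟨measurable_of_tendsto_metrizable (fun n => (continuous_one_sub_mul_dGamma_prm (d := d) γ n).measurable)
    (tendsto_pi_nhds.2 fun r => tendsto_one_sub_mul_dGamma_prm γ hγ0 hγ1 r), fun r => ?_⟩
  exact isClosed_Icc.mem_of_tendsto (tendsto_one_sub_mul_dGamma_prm γ hγ0 hγ1 r)
    (Eventually.of_forall fun n => one_sub_mul_dGamma_prm_mem_Icc γ hγ0 hγ1 n r)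

/-- `∫_q^p χ(r,γ) dr ≤ ∫_q^p χ^f(r) dr` (right side in `ℝ≥0∞`, no finiteness or measurability of `χ^f` needed). -/
theorem ofReal_integral_chiGamma_le_lintegral (γ : unitInterval) (hγ0 : 0 < (γ : ℝ)) (hγ1 : (γ : ℝ) ≤ 1) {q p : ℝ} (hqp : q ≤ p) :
    ENNReal.ofReal (∫ r in q..p, ∑' S : Finset (Site d), ((S.card : ℝ) * (1 - (γ : ℝ)) ^ S.card) *
        (bondPercolation (zdGraph d) (GhostField.prm r)).real (clusterIs 0 S)) ≤
      ∫⁻ r in Set.Ioc q p, meanClusterSize (zdGraph d) (0 : Site d) (GhostField.prm r) := by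
  obtain ⟨hmeas, hbd⟩ := measurable_chiGamma (d := d) γ hγ0 hγ1
  rw [intervalIntegral.integral_of_le hqp, ofReal_integral_eq_lintegral_ofReal]
  · exact lintegral_mono fun r => ofReal_chiGamma_le_meanClusterSize (GhostField.prm r) (by linarith) (by linarith)
  · exact Integrable.of_bound hmeas.aestronglyMeasurable (1 / (γ : ℝ)) (Eventually.of_forall fun r => by
      rw [Real.norm_eq_abs, abs_of_nonneg (hbd r).1]; exact (hbd r).2)
  · exact Eventually.of_forall fun r => (hbd r).1

/-- **The finite-cluster susceptibility is NOT integrable at `p_c` from the right, in every dimension `d ≥ 2`:**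
`∫_{p_c}^{p} χ^f(r) dr = ∞` for every `p ∈ (p_c, 1)`.  Proof: if the integral were finite it would be small on `(p_c, p')`
for `p'` close to `p_c`; then `magnetization_sub_le_mul_integral` (Lemma (5.51) integrated) gives
`M(q,γ) ≥ M(p',γ)/2 ≥ θ(p')/2` for all `q ∈ (p_c, p')` and all `γ`, hence (`γ ↓ 0`) `θ(q) ≥ θ(p')/2 > 0`, and (`q ↓ p_c`,
right-continuity, Grimmett Lemma (8.9)) `θ(p_c) ≥ θ(p')/2 > 0`, contradicting `θ(p_c) = 0` (p205010).  In exponent language this is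
"`γ' ≥ 1`" for every UPPER power-law envelope (see `not_chiF_le_rpow_of_lt_one`); the pointwise rate is `chiF_ge_of_theta_pos`.
builds on p205010 (kernel theorem, internal audit signed; external expert review pending). -/
theorem lintegral_meanClusterSize_eq_top (hd : 2 ≤ d) {p : ℝ} (hpc : (criticalProbI d : ℝ) < p) (hp1 : p < 1) :
    ∫⁻ r in Set.Ioo (criticalProbI d : ℝ) p, meanClusterSize (zdGraph d) (0 : Site d) (GhostField.prm r) = ⊤ := by
  by_contra hne
  set pc : ℝ := (criticalProbI d : ℝ) with hpcdef
  have hpc0 : 0 < pc := by rw [hpcdef, coe_criticalProbI]; exact criticalProb_zd_pos d (by omega)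
  have hθ0 : theta (zdGraph d) 0 (criticalProbI d) = 0 := CSH.percolationContinuity_allDimensions d hd
  have hd1 : 1 ≤ d := by omega
  have hd0 : (0 : ℝ) < d := by exact_mod_cast hd1
  set g : ℝ → ℝ≥0∞ := fun r => meanClusterSize (zdGraph d) (0 : Site d) (GhostField.prm r) with hg
  set K : ℝ := 2 * d / (1 - p) with hK
  have hK0 : 0 < K := div_pos (by positivity) (by linarith)
  have hprm : ∀ {r : ℝ}, 0 ≤ r → r ≤ 1 → ((GhostField.prm r : unitInterval) : ℝ) = r := fun h0 h1 => by
    simp [GhostField.prm, Set.projIcc_of_mem _ ⟨h0, h1⟩]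
  -- the measure `ν = g · Lebesgue` on `(p_c, p)` is finite; its mass near `p_c` tends to zero
  set ν : Measure ℝ := (volume.restrict (Set.Ioo pc p)).withDensity g with hν
  have hνs : ∀ s : Set ℝ, MeasurableSet s → ν s = ∫⁻ r in s ∩ Set.Ioo pc p, g r := by
    intro s hs
    rw [hν, withDensity_apply _ hs, Measure.restrict_restrict hs]
  have hνtop : ν Set.univ ≠ ⊤ := by
    rw [hνs _ MeasurableSet.univ, Set.univ_inter]; exact hne
  set s : ℕ → Set ℝ := fun m => Set.Iic (pc + 1 / ((m : ℝ) + 1)) with hs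
  have hanti : Antitone s := by
    intro m m' hmm'
    have hle : (m : ℝ) + 1 ≤ (m' : ℝ) + 1 := by exact_mod_cast Nat.add_le_add_right hmm' 1
    have hpos : (0 : ℝ) < (m : ℝ) + 1 := by positivity
    exact Set.Iic_subset_Iic.2 (by gcongr)
  have hinter : ν (⋂ m, s m) = 0 := by
    have hsub : (⋂ m, s m) ∩ Set.Ioo pc p = ∅ := by
      ext r
      simp only [Set.mem_inter_iff, Set.mem_iInter, hs, Set.mem_Iic, Set.mem_Ioo, Set.mem_empty_iff_false, iff_false,
        not_and, not_lt]
      intro hr hr1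
      exfalso
      -- `r ≤ pc + 1/(m+1)` for all `m` forces `r ≤ pc`
      have : r ≤ pc := by
        refine le_of_forall_pos_lt_add fun ε hε => ?_
        obtain ⟨m, hm⟩ := exists_nat_one_div_lt hε
        exact (hr m).trans_lt (by linarith)
      linarith
    rw [hνs _ (MeasurableSet.iInter fun m => measurableSet_Iic), hsub, Measure.restrict_empty, lintegral_zero_measure]
  have htail : Tendsto (fun m => ν (s m)) atTop (𝓝 0) := by
    rw [← hinter]
    exact tendsto_measure_iInter_atTop (fun m => measurableSet_Iic.nullMeasurableSet) hanti
      ⟨0, ne_top_of_le_ne_top hνtop (measure_mono (Set.subset_univ _))⟩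
  have hKinv : (0 : ℝ≥0∞) < ENNReal.ofReal (1 / (2 * K)) := ENNReal.ofReal_pos.2 (by positivity)
  obtain ⟨m, hm⟩ := ((tendsto_order.1 htail).2 _ hKinv).exists
  -- the intermediate point `p'`
  set p' : ℝ := min (pc + 1 / ((m : ℝ) + 1)) ((pc + p) / 2) with hp'
  have hm1 : (0 : ℝ) < 1 / ((m : ℝ) + 1) := by positivity
  have hp'c : pc < p' := lt_min (by linarith) (by linarith)
  have hp'p : p' < p := (min_le_right _ _).trans_lt (by linarith)
  have hp'1 : p' < 1 := hp'p.trans hp1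
  have hp's : p' ≤ pc + 1 / ((m : ℝ) + 1) := min_le_left _ _
  have hθp' : 0 < theta (zdGraph d) 0 (GhostField.prm p') :=
    theta_pos_of_criticalProb_lt_holds (zdGraph d) 0 (GhostField.prm p')
      (by rw [← coe_criticalProbI, hprm (hpc0.trans hp'c).le hp'1.le]; exact hp'c)
  -- main step: `θ(q) ≥ θ(p')/2` for all `q ∈ (p_c, p')`
  have hmain : ∀ q : ℝ, pc < q → q < p' → theta (zdGraph d) 0 (GhostField.prm p') / 2 ≤ theta (zdGraph d) 0 (GhostField.prm q) := by
    intro q hqc hqp'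
    have hq0 : 0 < q := hpc0.trans hqc
    -- the integral of `χ^f` over `(q, p']` is below `1/(2K)`
    have hJ : ∫⁻ r in Set.Ioc q p', g r < ENNReal.ofReal (1 / (2 * K)) := by
      refine lt_of_le_of_lt ?_ hm
      rw [hνs _ measurableSet_Iic]
      refine lintegral_mono_set fun r hr => ⟨hr.2.trans hp's, hqc.trans hr.1, hr.2.trans_lt hp'p⟩
    -- for every `γ_k = 1/(k+2)`: `M(q,γ) ≥ M(p',γ)/2 ≥ θ(p')/2`
    set γs : ℕ → unitInterval := fun k => ⟨1 / ((k : ℝ) + 2), by positivity, by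
      rw [div_le_one (by positivity)]; linarith⟩ with hγs
    have hγ0 : ∀ k, 0 < ((γs k : unitInterval) : ℝ) := fun k => by simp only [hγs]; positivity
    have hγ1 : ∀ k, ((γs k : unitInterval) : ℝ) < 1 := fun k => by
      simp only [hγs]; rw [div_lt_one (by positivity)]; linarith
    have hstep : ∀ k : ℕ, theta (zdGraph d) 0 (GhostField.prm p') / 2 ≤
        1 - clusterGF (zdGraph d) (0 : Site d) (GhostField.prm q) (1 - γs k) := by
      intro k
      have h := magnetization_sub_le_mul_integral (d := d) (γs k) (hγ0 k) (hγ1 k) hq0 hqp'.le hp'1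
      set Mp := 1 - clusterGF (zdGraph d) (0 : Site d) (GhostField.prm p') (1 - γs k) with hMp
      set Mq := 1 - clusterGF (zdGraph d) (0 : Site d) (GhostField.prm q) (1 - γs k) with hMq
      have hMp0 : 0 ≤ Mp := by
        rw [hMp, sub_nonneg]; exact clusterGF_le_one (zdGraph d) (0 : Site d) _ (by linarith [hγ1 k]) (by linarith [hγ0 k])
      have hMpθ : theta (zdGraph d) 0 (GhostField.prm p') ≤ Mp := by
        rw [hMp, le_sub_comm]
        exact clusterGF_le_one_sub_theta (GhostField.prm p') (by linarith [hγ1 k]) (by linarith [hγ0 k])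
      -- the integral of `χ(·,γ)` over `[q, p']` is below `1/(2K)`
      have hI : ∫ r in q..p', ∑' S : Finset (Site d), ((S.card : ℝ) * (1 - ((γs k : unitInterval) : ℝ)) ^ S.card) *
          (bondPercolation (zdGraph d) (GhostField.prm r)).real (clusterIs 0 S) ≤ 1 / (2 * K) := by
        have h1 := (ofReal_integral_chiGamma_le_lintegral (d := d) (γs k) (hγ0 k) (hγ1 k).le hqp'.le).trans_lt hJ
        exact (ENNReal.ofReal_lt_ofReal_iff (by positivity)).1 h1 |>.le
      have hI0 : 0 ≤ ∫ r in q..p', ∑' S : Finset (Site d), ((S.card : ℝ) * (1 - ((γs k : unitInterval) : ℝ)) ^ S.card) *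
          (bondPercolation (zdGraph d) (GhostField.prm r)).real (clusterIs 0 S) :=
        intervalIntegral.integral_nonneg hqp'.le fun r _ => ((measurable_chiGamma (d := d) (γs k) (hγ0 k) (hγ1 k).le).2 r).1
      have hK' : 2 * d / (1 - p') ≤ K := div_le_div_of_nonneg_left (by positivity) (by linarith) (by linarith)
      have h2 : Mp - Mq ≤ K * Mp * (1 / (2 * K)) := by
        refine h.trans ?_
        calc 2 * ↑d / (1 - p') * Mp * _ ≤ K * Mp * _ := by gcongr
          _ ≤ K * Mp * (1 / (2 * K)) := by gcongr
      have h3 : K * Mp * (1 / (2 * K)) = Mp / 2 := by field_simp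
      rw [h3] at h2
      linarith
    -- `γ_k ↓ 0`: `M(q,γ_k) → θ(q)`
    have hlim : Tendsto (fun k : ℕ => 1 - clusterGF (zdGraph d) (0 : Site d) (GhostField.prm q) (1 - γs k)) atTop
        (𝓝 (theta (zdGraph d) 0 (GhostField.prm q))) := by
      have := (tendsto_const_nhds (x := (1 : ℝ))).sub (tendsto_clusterGF_seq (d := d) (GhostField.prm q))
      rw [sub_sub_cancel] at this
      simpa [hγs] using this
    exact ge_of_tendsto' hlim hstep
  -- `q ↓ p_c` along `q_k = p_c + (p' - p_c)/(k+2)`: `θ(p_c) ≥ θ(p')/2 > 0`, contradiction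
  set qs : ℕ → ℝ := fun k => pc + (p' - pc) / ((k : ℝ) + 2) with hqs
  have hqs1 : ∀ k, pc < qs k := fun k => by
    have h1 : 0 < (p' - pc) / ((k : ℝ) + 2) := div_pos (by linarith) (by positivity)
    simp only [hqs]; linarith
  have hqs2 : ∀ k, qs k < p' := fun k => by
    have hk : (0 : ℝ) < (k : ℝ) + 2 := by positivity
    have h2 : (p' - pc) / ((k : ℝ) + 2) < p' - pc := by
      rw [div_lt_iff₀ hk]; nlinarith
    simp only [hqs]; linarith
  have hqlim : Tendsto qs atTop (𝓝 pc) := by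
    have h1 : Tendsto (fun k : ℕ => (p' - pc) / ((k : ℝ) + 2)) atTop (𝓝 0) := by
      have h := tendsto_one_div_add_atTop_nhds_zero_nat (𝕜 := ℝ)
      have h2 : Tendsto (fun k : ℕ => k + 1) atTop atTop := tendsto_add_atTop_nat 1
      have h3 := ((h.comp h2).const_mul (p' - pc))
      rw [mul_zero] at h3
      refine h3.congr fun k => ?_
      simp only [Function.comp_apply, Nat.cast_add, Nat.cast_one]; ring
    simpa [hqs] using (tendsto_const_nhds (x := pc)).add h1
  have hu : Tendsto (fun k => (GhostField.prm (qs k) : unitInterval)) atTop (𝓝[Set.Ici (criticalProbI d)] (criticalProbI d)) := by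
    refine tendsto_nhdsWithin_iff.2 ⟨?_, Eventually.of_forall fun k => ?_⟩
    · have hc : (GhostField.prm pc : unitInterval) = criticalProbI d := by
        apply Subtype.ext
        rw [hprm hpc0.le (by rw [hpcdef]; exact (criticalProbI d).2.2)]
      rw [← hc]
      exact (continuous_projIcc.tendsto pc).comp hqlim
    · show criticalProbI d ≤ GhostField.prm (qs k)
      have hc : (GhostField.prm pc : unitInterval) = criticalProbI d := by
        apply Subtype.ext
        rw [hprm hpc0.le (by rw [hpcdef]; exact (criticalProbI d).2.2)]
      rw [← hc]
      exact Set.monotone_projIcc _ (hqs1 k).le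
  have hθlim : Tendsto (fun k => theta (zdGraph d) 0 (GhostField.prm (qs k))) atTop (𝓝 0) := by
    have h := (theta_continuousWithinAt_Ici (d := d) (criticalProbI d)).tendsto.comp hu
    rwa [hθ0] at h
  have hge : theta (zdGraph d) 0 (GhostField.prm p') / 2 ≤ 0 :=
    ge_of_tendsto' hθlim fun k => hmain (qs k) (hqs1 k) (hqs2 k)
  linarith

/-- **"`γ' ≥ 1`" in upper-envelope form, every `d ≥ 2`:** no bound `χ^f(p) ≤ A (p - p_c)^{-g}` with `g < 1` can hold on a right
neighbourhood `(p_c, p_c + δ)` of `p_c` (such a bound would make `χ^f` integrable at `p_c⁺`, contradicting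
`lintegral_meanClusterSize_eq_top`).  Newman (1987) proves `γ' ≥ 2(1 - 1/δ)` assuming the exponents `γ', δ` exist; this statement
assumes nothing.  builds on p205010 (kernel theorem, internal audit signed; external expert review pending). -/
theorem not_chiF_le_rpow_of_lt_one (hd : 2 ≤ d) {A g δ : ℝ} (hg : g < 1) (hδ : 0 < δ) :
    ¬ ∀ p : unitInterval, (criticalProbI d : ℝ) < p → (p : ℝ) < criticalProbI d + δ →
      meanClusterSize (zdGraph d) (0 : Site d) p ≤ ENNReal.ofReal (A * ((p : ℝ) - criticalProbI d) ^ (-g)) := by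
  intro H
  set pc : ℝ := (criticalProbI d : ℝ) with hpcdef
  have hpc0 : 0 < pc := by rw [hpcdef, coe_criticalProbI]; exact criticalProb_zd_pos d (by omega)
  have hpc1 : pc < 1 := by rw [hpcdef, coe_criticalProbI]; exact criticalProb_zd_lt_one hd
  have hprm : ∀ {r : ℝ}, 0 ≤ r → r ≤ 1 → ((GhostField.prm r : unitInterval) : ℝ) = r := fun h0 h1 => by
    simp [GhostField.prm, Set.projIcc_of_mem _ ⟨h0, h1⟩]
  -- a point `p₁ ∈ (p_c, min(p_c + δ, 1))`
  set p₁ : ℝ := min (pc + δ / 2) ((pc + 1) / 2) with hp₁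
  have hp₁c : pc < p₁ := lt_min (by linarith) (by linarith)
  have hp₁1 : p₁ < 1 := (min_le_right _ _).trans_lt (by linarith)
  have hp₁δ : p₁ < pc + δ := (min_le_left _ _).trans_lt (by linarith)
  have htop := lintegral_meanClusterSize_eq_top hd hp₁c hp₁1
  -- but the envelope is integrable on `(p_c, p₁)`
  have hle : ∫⁻ r in Set.Ioo pc p₁, meanClusterSize (zdGraph d) (0 : Site d) (GhostField.prm r) ≤
      ∫⁻ r in Set.Ioo pc p₁, ENNReal.ofReal (A * (r - pc) ^ (-g)) := by
    refine setLIntegral_mono' measurableSet_Ioo fun r hr => ?_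
    have h := H (GhostField.prm r) (by rw [hprm (hpc0.trans hr.1).le (hr.2.trans hp₁1).le]; exact hr.1)
      (by rw [hprm (hpc0.trans hr.1).le (hr.2.trans hp₁1).le]; exact hr.2.trans hp₁δ)
    rwa [hprm (hpc0.trans hr.1).le (hr.2.trans hp₁1).le] at h
  have hfin : ∫⁻ r in Set.Ioo pc p₁, ENNReal.ofReal (A * (r - pc) ^ (-g)) < ⊤ := by
    have hint : IntervalIntegrable (fun r => A * (r - pc) ^ (-g)) volume pc p₁ := by
      have h1 : IntervalIntegrable (fun x : ℝ => x ^ (-g)) volume (pc - pc) (p₁ - pc) :=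
        intervalIntegral.intervalIntegrable_rpow' (by linarith)
      have h2 := (h1.comp_sub_right pc).const_mul A
      simpa using h2
    rw [intervalIntegrable_iff_integrableOn_Ioo_of_le hp₁c.le] at hint
    exact hint.lintegral_lt_top
  exact absurd (htop ▸ hle) (not_le.2 hfin)

end NonIntegrable

end ChiF

end Summit.CriticalPhenomena.PercolationContinuityZ3.Theorems
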